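import Summits.Ventures.YMGap.Conjectures.StrongCouplingSUNChiralLROMesonWeight
import Summits.Ventures.YMGap.Conjectures.StrongCouplingChiralLROMesonWeightAxisPermutation
import Literature.MathematicalPhysics.QuantumLattice.StaggeredChiralWardIdentity
import HarnessLib
import HarnessLib.Audit.Tags

/-!
# Lattice symmetries of the `β = 0` `SU(N)` meson moments with all-antiperiodic boundary condition:
# translations (slab sign flips), axis transpositions, and the chiral grading

Cell `pub-ymgap`, seat qcd-lit g26 (literature-prover), `bears_on: Q1` (Salmhofer–Seiler §5 p. 424, the
`SU(N)` case).  Everything is a theorem (0 facts, 0 sorry).  This file discharges the hypotheses `hT`, `hP`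
of `…SUNChiralLROMesonWeight…infraredBound_SU` and supplies the chiral grading of the kernel.

* RELABELLINGS (`siteRelabel g s` of `…MesonWeightTranslation`: `ψ_a(x) ↦ s(x)ψ_a(gx)`): if a link bijection
  `π` has `l(πb) = (g x_b, g y_b)` and the all-antiperiodic signs obey `Γ_{πb} = s(x_b)s(y_b)Γ_b`, then
  `ρ(−S_F(V)) = −S_F(V∘π⁻¹)` (`siteRelabel_negAction_zero`), `J(ρG) = det ρ · J(G)` by the invariance of
  `∏dV` under `π` (`suJ_siteRelabel`), `det ρ = 1` (`J(1) ≠ 0`), and the moments are invariant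
  (`mesonMomentSU_mapDomain_of_relabel`).
* TRANSLATIONS.  The all-antiperiodic signs are `η_μ(x)·(−1)^{[x_μ = L/2]}` (`apSigns_apply`); under the unit
  step `e_j` the seam moves, and is moved back by the SLAB SIGN FLIP `(−1)^{[x_j = L/2]}` on the fermions
  (`apAll_translate`), on top of the staggered shift sign `ζ_{e_j}` (`transSign`, `apSigns_translate`);
  unit steps generate: **`mesonMomentSU_mapDomain_addRight`**.  (For `U(N)` the seam is moved into the gauge
  field instead; for `SU(N)`, `N` odd, `−1 ∉ SU(N)` and the fermionic flip is the substitute.)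
* AXIS TRANSPOSITIONS.  The boundary signs `(−1)^{[x_μ = L/2]}` are invariant under permutations of the
  axes (`apAll_coordPerm_swap`), so the sign gauge `swapSign` of `…MesonWeightAxisPermutation` works verbatim
  (`apSigns_edgePerm_swap`): **`mesonMomentSU_mapDomain_axisSwap`** (adjacent transpositions generate).
* CHIRAL GRADING.  `J(ψ̄ψ(x)ψ̄ψ(y)) = 0` for `x, y` of equal parity, from the tree's `m = 0` selection rule at
  every gauge field (`berezin_meson_meson_fermiBoltzmann_massZero`): `suTwoPoint_eq_zero_of_sgn_eq`.

Honest framing: `β = 0`, finite even torus, `N` odd `≥ 3`; nothing about the thermodynamic or continuum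
limit or the summit's `QCD` conjunct.

## References
* [MontvayMunster1994] I. Montvay, G. Münster, *Quantum Fields on a Lattice*, CUP 1994, §4.3 (4.186)–(4.190).
* [SalmhoferSeiler1991] M. Salmhofer, E. Seiler, Commun. Math. Phys. 139 (1991) 395–432, §2 (2.3)–(2.4),
  (2.9)–(2.12), (3.100)–(3.101), (3.106), §5 p. 424.
* [Berezin1966] F. A. Berezin, *The Method of Second Quantization*, 1966, Ch. I §3.
-/

noncomputable section

open MeasureTheory Finset MvPolynomial
open scoped ComplexConjugate BigOperators ComplexOrder
open Literature.MathematicalPhysics.QuantumFieldTheory (Site Edge GaugeConfig torusEdgeShift torusEdgeShift_apply)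
open Literature.MathematicalPhysics.QuantumLattice
open Literature.MathematicalPhysics.QuantumLattice.GrassmannAlgebra
open Literature.MathematicalPhysics.QuantumLattice.StrongCoupling
open Literature.MathematicalPhysics.QuantumLattice.StaggeredShift (shiftSign phase_add_eq_shiftSign_mul cast_shiftSign_mul_self)
open Literature.MathematicalPhysics.StatisticalMechanics
open Literature.MathematicalPhysics.StatisticalMechanics.ComplexSpin
open Literature.Probability.LatticeModels (TorusSite)

namespace Summit.Ventures.YMGap.Conjectures

namespace MesonWeightSU

open MesonWeight

/-! ### Site relabellings carry the massless action to the action in a permuted gauge field -/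

section Relabel

variable {Λ : Type*} [LinearOrder Λ] [Fintype Λ] {N : ℕ} {B : Type*} [Fintype B]

/-- **Relabelling the massless action.**  If the site bijection `g`, the sign gauge `s` and the link
bijection `π` satisfy `l(πb) = (g x_b, g y_b)` and `Γ_{πb} = s(x_b)s(y_b)Γ_b`, then
`ρ_{g,s}(−S_F(U)) = −S_F(U ∘ π⁻¹)` (`m = 0`). [cite: MontvayMunster1994, §4.3 (4.186)–(4.190)] -/
theorem siteRelabel_negAction_zero (g : Λ ≃ Λ) (s : Λ → ℂ) (l : B → Λ × Λ) (Γ : B → ℂ) (π : B ≃ B)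
    (hl : ∀ b, l (π b) = (g (l b).1, g (l b).2)) (hΓ : ∀ b, Γ (π b) = s (l b).1 * s (l b).2 * Γ b)
    (U : B → OneLink.UN N) :
    siteRelabel N g s (negAction l Γ 0 U) = negAction l Γ 0 fun b => U (π.symm b) := by
  simp only [negAction, zero_smul, Finset.sum_const_zero, zero_add, map_sum, map_add, map_smul, siteRelabel_hopAt]
  refine Fintype.sum_equiv π _ _ fun b => ?_
  rw [hl, hΓ, Equiv.symm_apply_apply, smul_smul, smul_smul]
  congr 1
  · congr 1; ring
  · congr 1; ring

end Relabel

variable {N ν L : ℕ} [NeZero ν] [NeZero L] [LinearOrder (TorusSite ν L)]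

/-! ### The all-antiperiodic signs: `Γ_{(x,μ)} = η_μ(x) · (−1)^{[x_μ = L/2]}` -/

/-- The boundary-condition sign `(−1)^{[x_μ = L/2]}` of the link `(x, x + e_μ)`. [cite: SalmhoferSeiler1991, §2 (2.3)] -/
def apAll (x : TorusSite ν L) (μ : Fin ν) : ℂ := if (x μ).val = L / 2 then -1 else 1

omit [NeZero ν] [NeZero L] [LinearOrder (TorusSite ν L)] in
/-- `apAll² = 1`. [cite: SalmhoferSeiler1991, §2 (2.3)] -/
theorem apAll_mul_self (x : TorusSite ν L) (μ : Fin ν) : apAll x μ * apAll x μ = 1 := by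
  unfold apAll; split_ifs <;> norm_num

omit [NeZero ν] [NeZero L] [LinearOrder (TorusSite ν L)] in
/-- A unit step in a direction `j ≠ μ` does not change `x_μ`. [cite: SalmhoferSeiler1991, §2 (2.3)] -/
theorem apAll_add_single_of_ne {μ j : Fin ν} (h : μ ≠ j) (x : TorusSite ν L) :
    apAll (x + Pi.single j 1) μ = apAll x μ := by
  simp [apAll, Pi.add_apply, Pi.single_eq_of_ne h]

omit [NeZero ν] [NeZero L] [LinearOrder (TorusSite ν L)] in
/-- The boundary signs are invariant under a transposition of the axes. [cite: MontvayMunster1994, §4.3] -/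
theorem apAll_coordPerm_swap (j k : Fin ν) (x : TorusSite ν L) (μ : Fin ν) :
    apAll (coordPerm (Equiv.swap j k) x) (Equiv.swap j k μ) = apAll x μ := by
  simp [apAll, coordPerm_apply, Equiv.swap_apply_self]

omit [LinearOrder (TorusSite ν L)] in
/-- **The all-antiperiodic signs factorise**: `apSigns (x, μ) = η_μ(x) · (−1)^{[x_μ = L/2]}`. [cite: SalmhoferSeiler1991, §2 (2.3)–(2.4)] -/
theorem apSigns_apply (x : TorusSite ν L) (μ : Fin ν) : apSigns ν L (x, μ) = stagSigns ν L (x, μ) * apAll x μ := by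
  simp only [apSigns, StaggeredRP.apSignT, StaggeredRP.apSign, StaggeredRP.apTwist, StaggeredRP.apTwistSpatial, apAll,
    stagSigns]
  by_cases hμ : μ = 0
  · subst hμ
    by_cases h : (x 0).val = L / 2 <;> simp [h]
  · by_cases h : (x μ).val = L / 2 <;> simp [hμ, h]

/-! ### `J(ρG) = det ρ · J(G)` for relabellings compatible with the links and the signs -/

/-- `J(G) = ∫𝒟V ∫dψ̄dψ G e^{−S_F(V)}` (order of integrations exchanged). [cite: SalmhoferSeiler1991, §2 (2.9)] -/
theorem suJ_eq_integral (hL1 : 1 < L) (G : FermiAlg (TorusSite ν L) N) :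
    suJ N ν L G = ∫ V, berezin ℂ _ (G * fermiBoltzmannSU (torusLinks ν L) (apSigns ν L) 0 V)
      ∂(gaugeMeasureSU N (TorusSite ν L × Fin ν)) := by
  unfold suJ fermiBracketSU
  exact apply_cintegral (berezin ℂ _)
    (coeffIntegrable_mul_fermiBoltzmannSU _ (torusLinks_ne hL1) _ _ (CoeffContinuous.const G))

omit [NeZero ν] [LinearOrder (TorusSite ν L)] in
/-- `∏_b dV_b` is invariant under a permutation of the links. [cite: SalmhoferSeiler1991, §2 (2.12)] -/
theorem measurePreserving_arrowCongr_SU (π : (TorusSite ν L × Fin ν) ≃ (TorusSite ν L × Fin ν)) :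
    MeasurePreserving (MeasurableEquiv.arrowCongr' π (MeasurableEquiv.refl (OneLink.SUN N)))
      (gaugeMeasureSU N (TorusSite ν L × Fin ν)) (gaugeMeasureSU N (TorusSite ν L × Fin ν)) := by
  unfold gaugeMeasureSU
  exact measurePreserving_arrowCongr' _ _ π (MeasurableEquiv.refl _) fun _ => MeasurePreserving.id _

/-- **`J(ρ_{g,s} G) = det ρ_{g,s} · J(G)`** for a relabelling compatible with the torus links and the
all-antiperiodic signs (invariance of `∏dV` under the link permutation, `ρ(e^{−S_F(V)}) = e^{−S_F(V∘π⁻¹)}`,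
`∫dψ̄dψ ∘ ρ = det ρ · ∫dψ̄dψ`). [cite: SalmhoferSeiler1991, §2 (2.9)–(2.12)] [cite: Berezin1966, Ch. I §3] -/
theorem suJ_siteRelabel (hL1 : 1 < L) (g : TorusSite ν L ≃ TorusSite ν L) (s : TorusSite ν L → ℂ)
    (π : (TorusSite ν L × Fin ν) ≃ (TorusSite ν L × Fin ν))
    (hl : ∀ b, torusLinks ν L (π b) = (g (torusLinks ν L b).1, g (torusLinks ν L b).2))
    (hΓ : ∀ b, apSigns ν L (π b) = s (torusLinks ν L b).1 * s (torusLinks ν L b).2 * apSigns ν L b)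
    (G : FermiAlg (TorusSite ν L) N) :
    suJ N ν L (siteRelabel N g s G) = LinearMap.det (siteSubst (N := N) g s) * suJ N ν L G := by
  have hfB : ∀ V : TorusSite ν L × Fin ν → OneLink.SUN N,
      siteRelabel N g s (fermiBoltzmannSU (torusLinks ν L) (apSigns ν L) 0 V) =
        fermiBoltzmannSU (torusLinks ν L) (apSigns ν L) 0
          (MeasurableEquiv.arrowCongr' π (MeasurableEquiv.refl (OneLink.SUN N)) V) := fun V => by
    rw [fermiBoltzmannSU_eq_grassmannExp, fermiBoltzmannSU_eq_grassmannExp, map_grassmannExp_eq]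
    unfold negActionSU
    rw [siteRelabel_negAction_zero g s _ _ π hl hΓ]
    rfl
  rw [suJ_eq_integral hL1, suJ_eq_integral hL1, ← integral_const_mul,
    ← (measurePreserving_arrowCongr_SU (N := N) π).integral_comp (MeasurableEquiv.measurableEmbedding _)]
  refine integral_congr_ae (ae_of_all _ fun V => ?_)
  dsimp only
  rw [← hfB, ← map_mul, berezin_siteRelabel]

/-- **`det ρ_{g,s} = 1`** (test on `G = 1`, `J(1) ≠ 0`). [cite: Berezin1966, Ch. I §3] -/
theorem det_siteSubst_eq_one (hN : Odd N) (h1 : 1 < N) (hL : Even L) (g : TorusSite ν L ≃ TorusSite ν L)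
    (s : TorusSite ν L → ℂ) (π : (TorusSite ν L × Fin ν) ≃ (TorusSite ν L × Fin ν))
    (hl : ∀ b, torusLinks ν L (π b) = (g (torusLinks ν L b).1, g (torusLinks ν L b).2))
    (hΓ : ∀ b, apSigns ν L (π b) = s (torusLinks ν L b).1 * s (torusLinks ν L b).2 * apSigns ν L b) :
    LinearMap.det (siteSubst (N := N) g s) = 1 := by
  have h := suJ_siteRelabel (StaggeredRP.one_lt_of_even_neZero hL) g s π hl hΓ (1 : FermiAlg (TorusSite ν L) N)
  rw [map_one] at h
  exact (mul_eq_right₀ (suJ_one_ne_zero hN h1 hL)).1 h.symm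

/-- **The meson moments are invariant under every compatible relabelling** with a sign gauge `s² = 1`. [cite: SalmhoferSeiler1991, (3.100); MontvayMunster1994, §4.3] -/
theorem mesonMomentSU_mapDomain_of_relabel (hN : Odd N) (h1 : 1 < N) (hL : Even L)
    (g : TorusSite ν L ≃ TorusSite ν L) (s : TorusSite ν L → ℂ) (π : (TorusSite ν L × Fin ν) ≃ (TorusSite ν L × Fin ν))
    (hl : ∀ b, torusLinks ν L (π b) = (g (torusLinks ν L b).1, g (torusLinks ν L b).2))
    (hΓ : ∀ b, apSigns ν L (π b) = s (torusLinks ν L b).1 * s (torusLinks ν L b).2 * apSigns ν L b)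
    (hs : ∀ x, s x * s x = 1) (m : TorusSite ν L →₀ ℕ) :
    mesonMomentSU N ν L (Finsupp.mapDomain g m) = mesonMomentSU N ν L m := by
  rw [mesonMomentSU, mesonMomentSU, ← rename_monomial, ← siteRelabel_bos g hs,
    suJ_siteRelabel (StaggeredRP.one_lt_of_even_neZero hL) g s π hl hΓ, det_siteSubst_eq_one hN h1 hL g s π hl hΓ, one_mul]

/-! ### Translations: the staggered shift sign times a slab sign flip -/

/-- **The sign gauge of the unit translation in direction `j`**: `ζ_{e_j}(x) · (−1)^{[x_j = L/2]}` — the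
staggered shift sign of `StaggeredTranslationInvariance` times the slab flip that moves the antiperiodic
seam back. [cite: MontvayMunster1994, §4.3 (4.186)–(4.187)] -/
def transSign (j : Fin ν) (x : TorusSite ν L) : ℂ := ((shiftSign (Pi.single j 1) x : ℤ) : ℂ) * apAll x j

omit [NeZero ν] [NeZero L] [LinearOrder (TorusSite ν L)] in
/-- `transSign² = 1`. [cite: MontvayMunster1994, §4.3] -/
theorem transSign_mul_self (j : Fin ν) (x : TorusSite ν L) : transSign j x * transSign j x = 1 := by
  rw [transSign, mul_mul_mul_comm, cast_shiftSign_mul_self, apAll_mul_self, one_mul]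

omit [NeZero ν] [NeZero L] [LinearOrder (TorusSite ν L)] in
/-- The slab-flip identity `(−1)^{[(x+e_j)_μ = L/2]} = a(x) a(x+e_μ) (−1)^{[x_μ = L/2]}`, `a(x) = (−1)^{[x_j = L/2]}`. [cite: SalmhoferSeiler1991, §2 (2.3)] -/
theorem apAll_translate (j μ : Fin ν) (x : TorusSite ν L) :
    apAll (x + Pi.single j 1) μ = apAll x j * apAll (x + Pi.single μ 1) j * apAll x μ := by
  by_cases h : μ = j
  · subst h
    rw [mul_comm (apAll x μ) (apAll (x + Pi.single μ 1) μ), mul_assoc, apAll_mul_self, mul_one]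
  · rw [apAll_add_single_of_ne h, apAll_add_single_of_ne (Ne.symm h), apAll_mul_self, one_mul]

omit [LinearOrder (TorusSite ν L)] in
/-- **The all-antiperiodic signs under the unit translation**: `Γ_{b+e_j} = t_j(x_b) t_j(y_b) Γ_b`. [cite: MontvayMunster1994, §4.3 (4.186)–(4.187)] -/
theorem apSigns_translate (hL : Even L) (j : Fin ν) (b : TorusSite ν L × Fin ν) :
    apSigns ν L (torusEdgeShift (Pi.single j 1) b) =
      transSign j (torusLinks ν L b).1 * transSign j (torusLinks ν L b).2 * apSigns ν L b := by
  obtain ⟨x, μ⟩ := b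
  rw [torusEdgeShift_apply]
  dsimp only [torusLinks]
  rw [apSigns_apply, apSigns_apply, apAll_translate j μ x, transSign, transSign,
    show stagSigns ν L (x + Pi.single j 1, μ) =
        ((shiftSign (Pi.single j 1) x : ℤ) : ℂ) * ((shiftSign (Pi.single j 1) (x + Pi.single μ 1) : ℤ) : ℂ) *
          stagSigns ν L (x, μ) from phase_add_eq_shiftSign_mul hL (Pi.single j 1) x μ]
  ring

omit [NeZero ν] [NeZero L] [LinearOrder (TorusSite ν L)] in
/-- The unit translation maps the link `(x, x+e_μ)` to `(x+e_j, x+e_j+e_μ)`. [cite: MontvayMunster1994, §4.3] -/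
theorem torusLinks_torusEdgeShift (c : TorusSite ν L) (b : TorusSite ν L × Fin ν) :
    torusLinks ν L (torusEdgeShift c b) =
      (Equiv.addRight c (torusLinks ν L b).1, Equiv.addRight c (torusLinks ν L b).2) := by
  obtain ⟨x, μ⟩ := b
  rw [torusEdgeShift_apply]
  exact Prod.ext rfl (add_right_comm _ _ _)

/-- **The meson moments are invariant under the unit translations.** [cite: SalmhoferSeiler1991, (3.100); MontvayMunster1994, §4.3] -/
theorem mesonMomentSU_mapDomain_addRight_single (hN : Odd N) (h1 : 1 < N) (hL : Even L) (j : Fin ν)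
    (m : TorusSite ν L →₀ ℕ) :
    mesonMomentSU N ν L (Finsupp.mapDomain (Equiv.addRight (Pi.single j (1 : ZMod L))) m) = mesonMomentSU N ν L m :=
  mesonMomentSU_mapDomain_of_relabel hN h1 hL _ (transSign j) (torusEdgeShift (Pi.single j 1))
    (torusLinks_torusEdgeShift _) (apSigns_translate hL j) (transSign_mul_self j) m

/-- **THE MESON MOMENTS ARE TRANSLATION INVARIANT** (`w(m ∘ τ_c) = w(m)` for every `c`; unit steps
generate). Hypothesis `hT` of `infraredBound_SU`, discharged. [cite: SalmhoferSeiler1991, (3.100); MontvayMunster1994, §4.3] -/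
theorem mesonMomentSU_mapDomain_addRight (hN : Odd N) (h1 : 1 < N) (hL : Even L) (c : TorusSite ν L)
    (m : TorusSite ν L →₀ ℕ) :
    mesonMomentSU N ν L (Finsupp.mapDomain (Equiv.addRight c) m) = mesonMomentSU N ν L m := by
  -- the set of good translations is closed under `+` and contains the unit steps
  have hadd : ∀ a b : TorusSite ν L,
      (∀ m, mesonMomentSU N ν L (Finsupp.mapDomain (Equiv.addRight a) m) = mesonMomentSU N ν L m) →
      (∀ m, mesonMomentSU N ν L (Finsupp.mapDomain (Equiv.addRight b) m) = mesonMomentSU N ν L m) →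
      ∀ m, mesonMomentSU N ν L (Finsupp.mapDomain (Equiv.addRight (a + b)) m) = mesonMomentSU N ν L m := by
    intro a b ha hb m
    rw [show (⇑(Equiv.addRight (a + b)) : TorusSite ν L → TorusSite ν L) = ⇑(Equiv.addRight b) ∘ ⇑(Equiv.addRight a) from
      funext fun x => (add_assoc x a b).symm, Finsupp.mapDomain_comp, hb, ha]
  have hzero : ∀ m, mesonMomentSU N ν L (Finsupp.mapDomain (Equiv.addRight (0 : TorusSite ν L)) m) = mesonMomentSU N ν L m :=
    fun m => by rw [Equiv.addRight_zero, Equiv.Perm.coe_one, Finsupp.mapDomain_id]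
  have hnsmul : ∀ (j : Fin ν) (n : ℕ) (m : TorusSite ν L →₀ ℕ),
      mesonMomentSU N ν L (Finsupp.mapDomain (Equiv.addRight (n • (Pi.single j (1 : ZMod L) : TorusSite ν L))) m) =
        mesonMomentSU N ν L m := by
    intro j n
    induction n with
    | zero => rw [zero_smul]; exact hzero
    | succ n ih => rw [succ_nsmul]; exact hadd _ _ ih (mesonMomentSU_mapDomain_addRight_single hN h1 hL j)
  have hc : c = ∑ j, (c j).val • (Pi.single j (1 : ZMod L) : TorusSite ν L) := by
    funext i
    simp only [Finset.sum_apply, Pi.smul_apply, Pi.single_apply, smul_ite, smul_zero, Finset.sum_ite_eq,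
      Finset.mem_univ, if_true, nsmul_one, ZMod.natCast_zmod_val]
  rw [hc]
  have key : ∀ s : Finset (Fin ν), ∀ m,
      mesonMomentSU N ν L (Finsupp.mapDomain (Equiv.addRight (∑ j ∈ s, (c j).val • (Pi.single j (1 : ZMod L) : TorusSite ν L))) m) =
        mesonMomentSU N ν L m := by
    intro s
    classical
    induction s using Finset.induction_on with
    | empty => rw [Finset.sum_empty]; exact hzero
    | insert j s hj ih => rw [Finset.sum_insert hj]; exact hadd _ _ (hnsmul j _) ih
  exact key _ m

/-! ### Axis transpositions: the sign gauge of `…MesonWeightAxisPermutation`, boundary signs invariant -/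

omit [LinearOrder (TorusSite ν L)] in
/-- **The all-antiperiodic signs under the adjacent transposition `σ = (j, j+1)`**:
`Γ_{σb} = s(x_b) s(y_b) Γ_b` with `s = swapSign`. [cite: MontvayMunster1994, §4.3 (4.186)–(4.190)] -/
theorem apSigns_edgePerm_swap (hL : Even L) {j k : Fin ν} (hjk : (k : ℕ) = j + 1) (b : TorusSite ν L × Fin ν) :
    apSigns ν L (edgePerm (Equiv.swap j k) b) =
      swapSign j k (torusLinks ν L b).1 * swapSign j k (torusLinks ν L b).2 * apSigns ν L b := by
  obtain ⟨x, μ⟩ := b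
  rw [edgePerm_apply, Equiv.symm_swap]
  dsimp only [torusLinks]
  rw [apSigns_apply, apSigns_apply, ← swapSign_phase hL hjk x μ, apAll_coordPerm_swap]
  ring

omit [NeZero ν] [NeZero L] [LinearOrder (TorusSite ν L)] in
/-- The transposition maps the link `(x, x+e_μ)` to `(x∘σ, x∘σ + e_{σμ})`. [cite: MontvayMunster1994, §3.2] -/
theorem torusLinks_edgePerm (σ : Equiv.Perm (Fin ν)) (b : TorusSite ν L × Fin ν) :
    torusLinks ν L (edgePerm σ b) = (coordPerm σ (torusLinks ν L b).1, coordPerm σ (torusLinks ν L b).2) := by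
  obtain ⟨x, μ⟩ := b
  rw [edgePerm_apply]
  exact Prod.ext rfl (coordPerm_add_single σ x μ).symm

/-- **The meson moments are invariant under adjacent transpositions of the axes.** [cite: MontvayMunster1994, §4.3] -/
theorem mesonMomentSU_mapDomain_adjSwap (hN : Odd N) (h1 : 1 < N) (hL : Even L) {j k : Fin ν} (hjk : (k : ℕ) = j + 1)
    (m : TorusSite ν L →₀ ℕ) :
    mesonMomentSU N ν L (Finsupp.mapDomain (coordPerm (Equiv.swap j k)) m) = mesonMomentSU N ν L m :=
  mesonMomentSU_mapDomain_of_relabel hN h1 hL _ (swapSign j k) (edgePerm (Equiv.swap j k)) (torusLinks_edgePerm _)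
    (apSigns_edgePerm_swap hL hjk) (swapSign_mul_self j k) m

/-- **The meson moments are invariant under every permutation of the axes** (adjacent transpositions
generate). [cite: MontvayMunster1994, §4.3] -/
theorem mesonMomentSU_mapDomain_coordPerm (hN : Odd N) (h1 : 1 < N) (hL : Even L) (σ : Equiv.Perm (Fin ν))
    (m : TorusSite ν L →₀ ℕ) :
    mesonMomentSU N ν L (Finsupp.mapDomain (coordPerm σ) m) = mesonMomentSU N ν L m := by
  obtain ⟨n, hn⟩ := Nat.exists_eq_succ_of_ne_zero (NeZero.ne ν)
  subst hn
  have hσ : σ ∈ Submonoid.closure (Set.range fun i : Fin n => Equiv.swap i.castSucc i.succ) := by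
    rw [Equiv.Perm.mclosure_swap_castSucc_succ]; exact Submonoid.mem_top σ
  revert m
  refine Submonoid.closure_induction (fun τ hτ => ?_) (fun m => ?_) (fun τ τ' _ _ hτ hτ' m => ?_) hσ
  · obtain ⟨i, rfl⟩ := hτ
    exact fun m => mesonMomentSU_mapDomain_adjSwap hN h1 hL (by simp [Fin.val_succ]) m
  · rw [show (⇑(coordPerm (L := L) (1 : Equiv.Perm (Fin (n + 1)))) : TorusSite (n + 1) L → TorusSite (n + 1) L) = id
      from funext fun x => funext fun l => rfl, Finsupp.mapDomain_id]
  · rw [show (⇑(coordPerm (L := L) (τ * τ')) : TorusSite (n + 1) L → TorusSite (n + 1) L) =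
        ⇑(coordPerm (L := L) τ') ∘ ⇑(coordPerm (L := L) τ) from funext fun x => funext fun l => rfl,
      Finsupp.mapDomain_comp, hτ', hτ]

/-- **Hypothesis `hP` of `infraredBound_SU`, discharged**: invariance under the axis transpositions `axisSwap i`. [cite: MontvayMunster1994, §4.3] -/
theorem mesonMomentSU_mapDomain_axisSwap (hN : Odd N) (h1 : 1 < N) (hL : Even L) (i : Fin ν) (m : TorusSite ν L →₀ ℕ) :
    mesonMomentSU N ν L (Finsupp.mapDomain (axisSwap i) m) = mesonMomentSU N ν L m := by
  rw [show (⇑(axisSwap (L := L) i) : TorusSite ν L → TorusSite ν L) = ⇑(coordPerm (L := L) (Equiv.swap 0 i))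
    from funext fun x => rfl]
  exact mesonMomentSU_mapDomain_coordPerm hN h1 hL _ m

/-! ### The chiral grading of the two-point function at `m = 0` -/

/-- **`J(ψ̄ψ(x)ψ̄ψ(y)) = 0` for `x, y` of equal parity** (the `m = 0` selection rule (3.101), at every `SU(N)`
gauge field, then integrated). [cite: SalmhoferSeiler1991, (3.101) and (3.106)] -/
theorem suJ_meson_meson_eq_zero (hL : Even L) {x y : TorusSite ν L}
    (hxy : ComplexSpin.sgn hL.two_dvd x = ComplexSpin.sgn hL.two_dvd y) :
    suJ N ν L (meson x * meson y) = 0 := by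
  have hL1 := StaggeredRP.one_lt_of_even_neZero hL
  set ε : TorusSite ν L → ℂ := fun z => ((ComplexSpin.sgn hL.two_dvd z : ℤ) : ℂ) with hε
  have hε0 : ∑ z, ε z = 0 := by
    show ∑ z, ((ComplexSpin.sgn hL.two_dvd z : ℤ) : ℂ) = 0
    exact_mod_cast ComplexSpin.sum_sgn_eq_zero (ν := ν) hL.two_dvd NeZero.one_le
  have hl : ∀ b, ε (torusLinks ν L b).1 + ε (torusLinks ν L b).2 = 0 := fun b => by
    simp only [hε, torusLinks, ComplexSpin.sgn_add_single]
    push_cast; ring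
  have hxy' : ε x + ε y ≠ 0 := by
    simp only [hε, hxy]
    unfold ComplexSpin.sgn; split_ifs <;> norm_num
  rw [suJ_eq_integral hL1]
  simp_rw [fermiBoltzmannSU, berezin_meson_meson_fermiBoltzmann_massZero hε0 _ hl _ _ hxy']
  exact integral_zero _ _

/-- **The chiral grading**: `T(x, y) = 0` for `x, y` of equal parity. [cite: SalmhoferSeiler1991, (3.101) and (3.106)] -/
theorem suTwoPoint_eq_zero_of_sgn_eq (hL : Even L) {x y : TorusSite ν L}
    (hxy : ComplexSpin.sgn hL.two_dvd x = ComplexSpin.sgn hL.two_dvd y) : suTwoPoint N ν L x y = 0 := by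
  rw [suTwoPoint, fermiExpectSU_const_eq, suJ_meson_meson_eq_zero hL hxy, zero_div, Complex.zero_re]

end MesonWeightSU

end Summit.Ventures.YMGap.Conjectures

end
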